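import Literature.NumberTheory.Sieve.PolynomialCongruencesProofs
import Summits.Parity.BatemanHorn.Theorems.SoloInformedRootPairCRT

/-!
# Hooley's explicit bound is uniform in the frequency: the factor `√|h|`

Informed soloist `solo-Parity-informed` (session 144), conjunct `BatemanHorn`, the `d ≥ 3` rung BELOW the parity
wall.  The scale profiles typed in this line (`HooleyMeanProfile`, `HooleyMeanSquareProfile`,
`HooleyPairCorrelationProfile`) ask for bounds on the root Weyl sums `T(h) = ∑_{E<e≤E'} S_g(h;e)` on AVERAGE over
the frequencies `1 ≤ |h| ≤ H` with `H = H(E) → ∞`; the calibration file `SoloInformedHooleyProfileFixedScale` used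
Hooley's theorem (1964) only as `o(x)` for each FIXED `h`.  The question left open there (the line's Q21: is
Hooley's bound uniform in `h`, and with what loss?) is answered here FROM THE TREE: the tree's explicit form of
Hooley's estimate, `Literature.NumberTheory.Sieve.exists_norm_sum_polyRootWeylSum_le`
(`PolynomialCongruencesProofs.lean`), states its constants `δ, A₁, A₂, B` as depending on `(f, h)`, but its proof
instantiates them as `A₁ = 2K·√|h|·C₀·C_g`, `A₂ = C₀·C_R`, `B`, `δ` with `K, C₀, C_g, C_R, B, δ` depending on `f`
alone — the frequency enters ONLY through the crude bound `(h, a) ≤ |h|` for the gcd factor of the twisted second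
moment `∑_{r mod a}|S_f(hr, a)|² ≤ (h,a)·a·ρ_f(a)` (Hooley's `Σ₆`).  Re-running that proof with the quantifier over
`h` moved inside gives the UNIFORM statement:

* `exists_norm_sum_polyRootWeylSum_le_uniform`: for `f` irreducible of degree `n ≥ 2` there are `δ ∈ (0, 1/2]`
  and `A₁, A₂, B ≥ 0` depending on `f` only such that for EVERY `h ≠ 0`, all `x ∈ ℕ`, `z ≥ 4`, `t ≥ 0` with
  `3t ≤ log z`, `z^{10} log z ≤ x^{1/3}`:
  `|∑_{k≤x} S_f(h,k)| ≤ n^{log x/log z}·x·(A₁·√|h|·(log z)^{−δ} + A₂·e^{Bte^t}·(log z)·e^{−(t/3)(log x/log z)})`;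
* `exists_norm_sum_polyRootWeylSum_le_sqrt_mul`: the same with the whole bracket multiplied by `√|h|`
  (`|h| ≥ 1`), i.e. `|R_f(h, x)| ≤ √|h| · Φ_f(x, z, t)` with `Φ_f` free of `h` — Hooley's bound holds uniformly
  in the frequency at the cost of the factor `√|h|`;
* `norm_sum_Ioc_hooleySum_le_add`: the dyadic block `|∑_{E<e≤E'} S_g(h;e)| ≤ |R_g(h,E')| + |R_g(h,E)|` in the
  soloist's notation (`hooleySum = polyRootWeylSum`, `SoloInformedRootPairCRT`).

Consequence for the profiles (prose, recorded in the line's SHARPEST-STATEMENT §4.A): with Hooley's choice of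
`z, t` the right side is `√|h|·x·(log x)^{−δ/2+o(1)}`, so the `ε`-part of the `ℓ¹` profile
`∑_{1≤|h|≤H}|T(h)| ≤ εE` is KNOWN at the growing scales `H ≤ (log E)^{c}` for some `c = c(f) > 0` — and, since every
proof of Hooley's theorem bounds `∑_e |S_g(h;e)|` with the absolute values INSIDE, while
`∑_{E<p≤2E, ρ_g(p)=1} |S_g(h;p)| = #{E < p ≤ 2E : ρ_g(p) = 1} ≫ E/log E` for a non-cyclic cubic, no such proof
reaches `H ≫ log E`: beyond `H ≈ log E` the profile demands cancellation AMONG the moduli for single frequencies.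
The proof of the first theorem is the tree's proof of `exists_norm_sum_polyRootWeylSum_le` verbatim (Hooley 1964,
architecture per Martin–Sitar 2011 §3.2), with `h` introduced after the constants.
-/

namespace Summit.Parity.BatemanHorn.Theorems

open scoped BigOperators
open Finset Polynomial Literature.NumberTheory.Sieve

/-- **Hooley's explicit estimate, uniform in the frequency.**  For `f ∈ ℤ[X]` irreducible of degree `n ≥ 2`
there are `δ ∈ (0, 1/2]` and `A₁, A₂, B ≥ 0` (depending on `f` only) such that for every `h ≠ 0`, all
`x ∈ ℕ`, real `z ≥ 4` and `t ≥ 0` with `3t ≤ log z` and `z^{10} log z ≤ x^{1/3}`,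
`|∑_{k≤x} S_f(h,k)| ≤ n^{log x/log z} · x · (A₁ √|h| (log z)^{-δ} + A₂ e^{B t e^t} (log z) e^{-(t/3)(log x/log z)})`.
The tree's `exists_norm_sum_polyRootWeylSum_le` with the quantifier over `h` moved inside: its proof, verbatim,
already produces `A₁ = 2K √|h| C₀ C_g` with `K, C₀, C_g` free of `h`. -/
theorem exists_norm_sum_polyRootWeylSum_le_uniform {f : ℤ[X]} (hirr : Irreducible f)
    (hdeg : 2 ≤ f.natDegree) :
    ∃ δ : ℝ, 0 < δ ∧ δ ≤ 1 / 2 ∧ ∃ A₁ A₂ B : ℝ, 0 ≤ A₁ ∧ 0 ≤ A₂ ∧ 0 ≤ B ∧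
      ∀ (h : ℤ), h ≠ 0 → ∀ (x : ℕ) (z t : ℝ), 4 ≤ z → 0 ≤ t → 3 * t ≤ Real.log z →
        z ^ (10 : ℕ) * Real.log z ≤ (x : ℝ) ^ ((1 : ℝ) / 3) →
        ‖∑ k ∈ Icc 1 x, polyRootWeylSum f k h‖ ≤
          (f.natDegree : ℝ) ^ (Real.log x / Real.log z) * x *
            (A₁ * Real.sqrt (h.natAbs) * Real.log z ^ (-δ) +
              A₂ * Real.exp (B * t * Real.exp t) * Real.log z *
                Real.exp (-(t / 3) * (Real.log x / Real.log z))) := by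
  have hdeg0 : 0 < f.natDegree := by omega
  obtain ⟨C₀, -, hC₀⟩ := exists_polyRootCountMod_le_mul_pow_card_primeFactors hirr hdeg0
  obtain ⟨K, hKpos, hK⟩ := card_roughAP_le_of_smooth
  obtain ⟨CR, B, hCR, hB0, hR⟩ := exists_sum_smooth_rootCount_div_le hirr hdeg0
  obtain ⟨δ, hδ, hδ2, Cg, hCg, hG⟩ := exists_sum_smooth_sqrt_rootCount_div_le hirr hdeg
  refine ⟨δ, hδ, hδ2, 2 * K * C₀ * Cg, C₀ * CR, B, by positivity,
    by positivity, hB0, fun h hh x z t hz ht htz hzx => ?_⟩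
  set n : ℕ := f.natDegree with hn
  set N : ℕ := ⌈z⌉₊ with hN
  have hz1 : 1 < z := by linarith
  have hz2 : 2 ≤ z := by linarith
  have hz3 : 3 ≤ z := by linarith
  have hz0 : 0 < z := by linarith
  have hlogz : 0 < Real.log z := Real.log_pos hz1
  set w : ℝ := (x : ℝ) ^ ((1 : ℝ) / 3) with hw
  have hw0' : 0 ≤ w := by positivity
  have hw3 : w ^ 3 = x := rpow_third_pow_three (Nat.cast_nonneg x)
  -- `x ≥ 1`
  have hzw : 0 < z ^ (10 : ℕ) * Real.log z := by positivity
  have hwpos : 0 < w := lt_of_lt_of_le hzw hzx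
  have hx0' : (0 : ℝ) < x := by rw [← hw3]; positivity
  -- the uniform bound for `ρ_f` on the rough cofactors
  set Ξ : ℝ := C₀ * (n : ℝ) ^ (Real.log x / Real.log z) with hΞ
  have hΞ0 : 0 ≤ Ξ := by positivity
  have hΞb : ∀ a ∈ Nat.smoothNumbersUpTo x N, ∀ b ∈ roughIcc N (x / a),
      (polyRootCountMod ![f] b : ℝ) ≤ Ξ := by
    intro a _ b hb
    have hb' := mem_roughIcc.1 hb
    exact polyRootCountMod_le_of_rough hC₀ hdeg0 hz1 (by omega) (hb'.1.2.trans (Nat.div_le_self x a))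
      (le_of_mem_roughIcc_ceil hb)
  -- the smooth–rough decomposition, split at `a³ ≤ x`
  rw [sum_Icc_eq_sum_smooth_sum_rough (fun k => polyRootWeylSum f k h) N x]
  set S := Nat.smoothNumbersUpTo x N with hS
  have hSsm : ∀ k ∈ S, k ∈ Nat.smoothNumbers N := fun k hk => (Nat.mem_smoothNumbersUpTo.1 hk).2
  set T : ℕ → ℂ := fun a => ∑ b ∈ roughIcc N (x / a), polyRootWeylSum f (a * b) h with hT
  have hsplit : ∑ a ∈ S, T a =
      ∑ a ∈ S.filter (fun a => a ^ 3 ≤ x), T a + ∑ a ∈ S.filter (fun a => x < a ^ 3), T a := by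
    rw [← Finset.sum_filter_add_sum_filter_not S (fun a => a ^ 3 ≤ x)]
    congr 1
    refine Finset.sum_congr (Finset.filter_congr fun a _ => ?_) fun _ _ => rfl
    exact not_le
  -- `Σ₂`
  have hSig2 : ‖∑ a ∈ S.filter (fun a => x < a ^ 3), T a‖ ≤
      Ξ * x * (CR * Real.exp (B * t * Real.exp t) * Real.log z *
        Real.exp (-(t / 3) * (Real.log x / Real.log z))) := by
    refine (norm_sigma2_le f h hΞ0 hΞb).trans (mul_le_mul_of_nonneg_left ?_ (by positivity))
    -- `a³ > x` implies `a > w`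
    have hsub : S.filter (fun a => x < a ^ 3) ⊆ S.filter (fun a : ℕ => w < (a : ℝ)) := by
      intro a ha
      rw [mem_filter] at ha ⊢
      refine ⟨ha.1, ?_⟩
      by_contra hle
      rw [not_lt] at hle
      have : ((a : ℕ) : ℝ) ^ 3 ≤ w ^ 3 := pow_le_pow_left₀ (Nat.cast_nonneg a) hle 3
      rw [hw3] at this
      have h2 : (x : ℝ) < ((a ^ 3 : ℕ) : ℝ) := by exact_mod_cast ha.2
      push_cast at h2
      linarith
    calc ∑ a ∈ S.filter (fun a => x < a ^ 3), (polyRootCountMod ![f] a : ℝ) / a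
        ≤ ∑ a ∈ S.filter (fun a : ℕ => w < (a : ℝ)), (polyRootCountMod ![f] a : ℝ) / a :=
          Finset.sum_le_sum_of_subset_of_nonneg hsub fun a _ _ => by positivity
      _ ≤ CR * Real.exp (B * t * Real.exp t) * Real.log z * w ^ (-(t / Real.log z)) :=
          hR z hz3 t ht htz S hSsm w hwpos
      _ = _ := by
          congr 1
          rw [hw, ← Real.rpow_mul (Nat.cast_nonneg x), Real.rpow_def_of_pos hx0']
          congr 1
          field_simp
  -- `Σ₁`
  have hSig1 : ‖∑ a ∈ S.filter (fun a => a ^ 3 ≤ x), T a‖ ≤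
      Ξ * x * (2 * K * Real.sqrt (h.natAbs) * Cg * Real.log z ^ (-δ)) := by
    have hterm : ∀ a ∈ S.filter (fun a => a ^ 3 ≤ x), ‖T a‖ ≤
        (2 * K * Real.sqrt (h.natAbs) * Ξ * ((x : ℝ) / Real.log z)) *
          (Real.sqrt ((polyRootCountMod ![f] a : ℝ) * a / Nat.totient a) / a) := by
      intro a ha
      rw [mem_filter] at ha
      obtain ⟨haS, ha3⟩ := ha
      have hsm := hSsm a haS
      have ha0 : a ≠ 0 := Nat.ne_zero_of_mem_smoothNumbers hsm
      have hapos : (0 : ℝ) < a := by exact_mod_cast Nat.pos_of_ne_zero ha0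
      have hφ0 : (0 : ℝ) < Nat.totient a := by exact_mod_cast Nat.totient_pos.2 (Nat.pos_of_ne_zero ha0)
      have hφa : (Nat.totient a : ℝ) ≤ a := by exact_mod_cast Nat.totient_le a
      -- `a ≤ w`
      have haw : (a : ℝ) ≤ w := by
        have h3 : ((a : ℕ) : ℝ) ^ 3 ≤ w ^ 3 := by
          rw [hw3]; exact_mod_cast ha3
        exact le_of_pow_le_pow_left₀ (by norm_num) hw0' h3
      -- the absorption condition
      have hcond : z ^ (10 : ℕ) ≤ ((x : ℝ) / a) / ((Nat.totient a : ℝ) * Real.log z) := by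
        rw [le_div_iff₀ (by positivity), le_div_iff₀ hapos]
        calc z ^ (10 : ℕ) * ((Nat.totient a : ℝ) * Real.log z) * a
            ≤ (z ^ (10 : ℕ) * Real.log z) * (a * a) := by
              have : z ^ (10 : ℕ) * ((Nat.totient a : ℝ) * Real.log z) * a =
                (z ^ (10 : ℕ) * Real.log z) * (Nat.totient a * a) := by ring
              rw [this]
              exact mul_le_mul_of_nonneg_left (mul_le_mul_of_nonneg_right hφa hapos.le) hzw.le
          _ ≤ w * (w * w) := by
              refine mul_le_mul hzx ?_ (by positivity) hw0'
              exact mul_le_mul haw haw hapos.le hw0'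
          _ = x := by rw [← hw3]; ring
      refine (norm_sigma1_term_le f h hK hh hz2 haS hΞ0 (hΞb a haS) hcond).trans (le_of_eq ?_)
      field_simp
    calc ‖∑ a ∈ S.filter (fun a => a ^ 3 ≤ x), T a‖
        ≤ ∑ a ∈ S.filter (fun a => a ^ 3 ≤ x), ‖T a‖ := norm_sum_le _ _
      _ ≤ ∑ a ∈ S.filter (fun a => a ^ 3 ≤ x),
            (2 * K * Real.sqrt (h.natAbs) * Ξ * ((x : ℝ) / Real.log z)) *
              (Real.sqrt ((polyRootCountMod ![f] a : ℝ) * a / Nat.totient a) / a) :=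
          Finset.sum_le_sum hterm
      _ = (2 * K * Real.sqrt (h.natAbs) * Ξ * ((x : ℝ) / Real.log z)) *
            ∑ a ∈ S.filter (fun a => a ^ 3 ≤ x),
              Real.sqrt ((polyRootCountMod ![f] a : ℝ) * a / Nat.totient a) / a := by
          rw [Finset.mul_sum]
      _ ≤ (2 * K * Real.sqrt (h.natAbs) * Ξ * ((x : ℝ) / Real.log z)) *
            ∑ a ∈ S, Real.sqrt ((polyRootCountMod ![f] a : ℝ) * a / Nat.totient a) / a := by
          refine mul_le_mul_of_nonneg_left ?_ (by positivity)
          exact Finset.sum_le_sum_of_subset_of_nonneg (Finset.filter_subset _ _)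
            fun a _ _ => by positivity
      _ ≤ (2 * K * Real.sqrt (h.natAbs) * Ξ * ((x : ℝ) / Real.log z)) * (Cg * Real.log z ^ (1 - δ)) :=
          mul_le_mul_of_nonneg_left (hG z hz S hSsm) (by positivity)
      _ = Ξ * x * (2 * K * Real.sqrt (h.natAbs) * Cg * Real.log z ^ (-δ)) := by
          rw [show (-δ) = (1 - δ) - 1 by ring, Real.rpow_sub_one hlogz.ne']
          field_simp
  -- combine
  calc ‖∑ a ∈ S, T a‖
      = ‖∑ a ∈ S.filter (fun a => a ^ 3 ≤ x), T a + ∑ a ∈ S.filter (fun a => x < a ^ 3), T a‖ := by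
        rw [hsplit]
    _ ≤ ‖∑ a ∈ S.filter (fun a => a ^ 3 ≤ x), T a‖ + ‖∑ a ∈ S.filter (fun a => x < a ^ 3), T a‖ :=
        norm_add_le _ _
    _ ≤ Ξ * x * (2 * K * Real.sqrt (h.natAbs) * Cg * Real.log z ^ (-δ)) +
          Ξ * x * (CR * Real.exp (B * t * Real.exp t) * Real.log z *
            Real.exp (-(t / 3) * (Real.log x / Real.log z))) := add_le_add hSig1 hSig2
    _ = _ := by rw [hΞ]; ring

/-- **Uniformity in the frequency, displayed**: with `δ, A₁, A₂, B` as above (depending on `f` only), for every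
`h ≠ 0`: `|∑_{k≤x} S_f(h,k)| ≤ √|h| · n^{log x/log z}·x·(A₁ (log z)^{-δ} + A₂ e^{Bte^t}(log z)e^{-(t/3)(log x/log z)})`
— Hooley's bound in the tree's explicit form holds for all frequencies at once at the cost of the factor `√|h|`
(`|h| ≥ 1` absorbs the `Σ₂` term). -/
theorem exists_norm_sum_polyRootWeylSum_le_sqrt_mul {f : ℤ[X]} (hirr : Irreducible f)
    (hdeg : 2 ≤ f.natDegree) :
    ∃ δ : ℝ, 0 < δ ∧ δ ≤ 1 / 2 ∧ ∃ A₁ A₂ B : ℝ, 0 ≤ A₁ ∧ 0 ≤ A₂ ∧ 0 ≤ B ∧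
      ∀ (h : ℤ), h ≠ 0 → ∀ (x : ℕ) (z t : ℝ), 4 ≤ z → 0 ≤ t → 3 * t ≤ Real.log z →
        z ^ (10 : ℕ) * Real.log z ≤ (x : ℝ) ^ ((1 : ℝ) / 3) →
        ‖∑ k ∈ Icc 1 x, polyRootWeylSum f k h‖ ≤
          Real.sqrt (h.natAbs) * ((f.natDegree : ℝ) ^ (Real.log x / Real.log z) * x *
            (A₁ * Real.log z ^ (-δ) +
              A₂ * Real.exp (B * t * Real.exp t) * Real.log z *
                Real.exp (-(t / 3) * (Real.log x / Real.log z)))) := by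
  obtain ⟨δ, hδ, hδ2, A₁, A₂, B, hA₁, hA₂, hB, hmain⟩ :=
    exists_norm_sum_polyRootWeylSum_le_uniform hirr hdeg
  refine ⟨δ, hδ, hδ2, A₁, A₂, B, hA₁, hA₂, hB, fun h hh x z t hz ht htz hzx => ?_⟩
  have h1 : (1 : ℝ) ≤ Real.sqrt (h.natAbs) := by
    rw [Real.one_le_sqrt]
    exact_mod_cast Int.natAbs_pos.2 hh
  have hz1 : 1 < z := by linarith
  have hlogz : 0 < Real.log z := Real.log_pos hz1
  have hP : 0 ≤ (f.natDegree : ℝ) ^ (Real.log x / Real.log z) * x := by positivity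
  have hT2 : 0 ≤ A₂ * Real.exp (B * t * Real.exp t) * Real.log z *
      Real.exp (-(t / 3) * (Real.log x / Real.log z)) := by positivity
  refine (hmain h hh x z t hz ht htz hzx).trans ?_
  have key : A₁ * Real.sqrt (h.natAbs) * Real.log z ^ (-δ) +
      A₂ * Real.exp (B * t * Real.exp t) * Real.log z * Real.exp (-(t / 3) * (Real.log x / Real.log z)) ≤
      Real.sqrt (h.natAbs) * (A₁ * Real.log z ^ (-δ) +
        A₂ * Real.exp (B * t * Real.exp t) * Real.log z * Real.exp (-(t / 3) * (Real.log x / Real.log z))) := by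
    rw [mul_add]
    refine add_le_add (le_of_eq (by ring)) ?_
    exact le_mul_of_one_le_left hT2 h1
  calc (f.natDegree : ℝ) ^ (Real.log x / Real.log z) * x *
        (A₁ * Real.sqrt (h.natAbs) * Real.log z ^ (-δ) +
          A₂ * Real.exp (B * t * Real.exp t) * Real.log z *
            Real.exp (-(t / 3) * (Real.log x / Real.log z)))
      ≤ (f.natDegree : ℝ) ^ (Real.log x / Real.log z) * x *
        (Real.sqrt (h.natAbs) * (A₁ * Real.log z ^ (-δ) +
          A₂ * Real.exp (B * t * Real.exp t) * Real.log z *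
            Real.exp (-(t / 3) * (Real.log x / Real.log z)))) :=
        mul_le_mul_of_nonneg_left key hP
    _ = _ := by ring

/-- The dyadic block form used by the profiles: for every `h` and `E ≤ E'`,
`|∑_{E<e≤E'} S_g(h;e)| ≤ |R_g(h,E')| + |R_g(h,E)|` with `R_g(h,x) = ∑_{k≤x} S_g(h,k)` (the soloist's `hooleySum`
equals the Literature `polyRootWeylSum` by `hooleySum_eq_polyRootWeylSum`). -/
theorem norm_sum_Ioc_hooleySum_le_add (g : ℤ[X]) (h : ℤ) {E E' : ℕ} (hEE' : E ≤ E') :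
    ‖∑ e ∈ Ioc E E', hooleySum g e h‖ ≤
      ‖∑ k ∈ Icc 1 E', polyRootWeylSum g k h‖ + ‖∑ k ∈ Icc 1 E, polyRootWeylSum g k h‖ := by
  have h1 : Icc 1 E' = Ioc 0 E' := by
    ext k; simp [Nat.one_le_iff_ne_zero, Nat.pos_iff_ne_zero]
  have h2 : Icc 1 E = Ioc 0 E := by
    ext k; simp [Nat.one_le_iff_ne_zero, Nat.pos_iff_ne_zero]
  have hsplit : ∑ k ∈ Icc 1 E', polyRootWeylSum g k h =
      ∑ k ∈ Icc 1 E, polyRootWeylSum g k h + ∑ e ∈ Ioc E E', hooleySum g e h := by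
    rw [h1, h2, ← Finset.sum_Ioc_consecutive _ (Nat.zero_le E) hEE']
    congr 1
    exact Finset.sum_congr rfl fun e _ => (hooleySum_eq_polyRootWeylSum g e h).symm
  have : ∑ e ∈ Ioc E E', hooleySum g e h =
      ∑ k ∈ Icc 1 E', polyRootWeylSum g k h - ∑ k ∈ Icc 1 E, polyRootWeylSum g k h := by
    rw [hsplit]; ring
  rw [this]
  exact norm_sub_le _ _

end Summit.Parity.BatemanHorn.Theorems
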